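import Literature.MathematicalPhysics.QuantumFieldTheory.Balaban1983to89.B7Eq123General
import Literature.MathematicalPhysics.QuantumFieldTheory.Balaban1983to89.B8Ineq130
import Literature.MathematicalPhysics.QuantumFieldTheory.Balaban1983to89.B8Eq146AExpansion

/-!
# `Balaban1983to89.B7Eq123LogCovIterLevelOne` — [Balaban1985Averaging] Proposition 3's remainder (122)–(123) READ ON THE LEVEL-1
# FLAT COMPOSITE (127): `Q₁(1, ηA) = L·Q₁(1)(ηA) + C(1, ηA)` at every coarse bond, with `‖C‖ ≤ 131072(d+1)²L²·|ηA|²`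

statement-level skeleton of published theorems with citation tags; proofs where landed; nothing here is a claim about the
Yang–Mills mass gap

Source: T. Bałaban, *Averaging operations for lattice gauge theories*, Commun. Math. Phys. **98**, 17–51 (1985) [Balaban1985Averaging]
(cell paper B7), Proposition 3 (121)–(123) p. 36 and the composites (127) p. 37 / p. 38 («Q_{j+1}(U₀, ηA) = Q(Ū₀ʲ, Q_j(U₀, ηA))»).  Print
(verbatim, p. 36, as quoted in `B7Prop3GeneralLinear`): *"Q(V₀, A, c) = L(Q(V₀)A)_c + C(V₀, A, c). (122)  C(V₀, A, c) is an analytic function of A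
whose Taylor's expansion begins with a second-order polynomial (a quadratic form), and |C(V₀, A, c)| ≤ C₁L²|A|² < C₁(Lα₁)². (123)"*.

CITATION HEADER (lean-in-tree rule).  Cell `pub-ymgap` (YM Track A, HUMAN RULING D-0062; director-ym №197 width seats), node N16 = NE3, seat
`pub-ymgap-dag-n16-w2` (g0).  WHY: dag-n05-d g10's certificate `B8Prop3ShellModeVacuity` (INTENT-3, bus l.24287: [Balaban1985RegularSpaces] Prop. 3
AS TYPED on node N05's record family over `IdxB8SubB` is refuted at dag-n05-c's interior-shell member) reads the (1.42) hypothesis `C137` of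
n05-a's member `B8LeafModelZd3.zdGF3` through the NONLINEAR level-1 composite `B7Prop4GeneralLevels.logCovIter L U₀ (iEta η A′) 1`, whose LINEAR part
`linCovIter … 1` vanishes on the shell mode (dag-n05-c `B8SockB9P3ShellModeVacuityUniv.linCovIter_one_grad_level_one`); what is left is the remainder
`C(1, ·, c)` of (122), bounded by (123) — landed as `B7Eq123General.norm_Ccov_le_explicit` (b2b-t4 lineage).  This file is the thin COMPOSITION
of those two landed facts at the flat background, in the consumer's currencies (`logCovIter` / `linCovIter` / `iEta`).

WHAT THIS FILE PROVES (kernel, 0 `sorry`, 0 `def`; general coefficient algebra `𝔸` — no commutativity is used):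
* §1 (bookkeeping of (127) at `j = 0 → 1`, `U₀ = 1`): `logCovIter_one_level_one_eq_Qcov`, `linCovIter_one_level_one_eq_linQcov`, and (122) on the
  composite, `logCovIter_one_level_one_eq_lin_add_Ccov` : `logCovIter L 1 B 1 z κ = linCovIter L 1 B 1 z κ + Ccov L 1 B (L•z) κ`.
* §2 ★ `norm_logCovIter_one_level_one_le` : for `L ≥ 1` and `sup_b ‖B b‖ ≤ a ≤ c₃(d, L)`,
  `‖logCovIter L 1 B 1 z κ‖ ≤ ‖linCovIter L 1 B 1 z κ‖ + 131072(d+1)²L²·a²` ((123) with print's constant explicit; the flat background is regular with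
  `‖W_x(1) − 1‖ = 0`, `B8Ineq130.Wcx_one`); ★ `norm_logCovIter_one_level_one_le_of_lin_eq_zero` (vanishing linear part ⇒ `≤ 131072(d+1)²L²·a²`);
  `norm_logCovIter_iEta_one_level_one_le_of_lin_eq_zero` (the same in the currency `B = iEta η A′`, `sup ‖A′‖ ≤ T`, `ηT ≤ c₃`).

HONEST SCOPE.  By-name composition of landed theorems; the analytic content is `B7Eq123General` (Prop. 3 (123)), not re-proved; nothing new of Bałaban is
asserted; the N05 certificate this serves refutes a TYPED slot stronger than print (print's (1.42) ranges over 𝔅_k with the (1.31) crossing contours and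
is untouched); N05 ∕ N16 NOT discharged; count-neutral; one finite `T⁴` programme at fixed `ε`, Bałaban as printed — nothing continuum ∕ ℝ⁴ ∕ OS ∕
mass gap ∕ Clay.  No `sorry`, no `def`, no `instance`, no `notation`.  Unit `pub-ymgap-dag-n16-w2` (g0), 2026-08-27.
-/

noncomputable section

open NormedSpace

namespace Literature.MathematicalPhysics.QuantumFieldTheory.Balaban1983to89.B7Eq123LogCovIterLevelOne

open B7Prop1Explicit (U1 Wcx boxVec)
open B7Prop2Explicit (avgIter avgIter_zero)
open B7Prop3Flat (c3 c3_pos)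
open B7Prop3GeneralLinear (Qcov linQcov Ccov Qcov_eq_linQcov_add_Ccov)
open B7Prop4GeneralLevels (logCovIter linCovIter logCovIter_zero logCovIter_succ linCovIter_zero linCovIter_succ)
open B7Eq123General (norm_Ccov_le_explicit)
open B8Eq146AExpansion (iEta norm_iEta_le)

-- `Site` alone could resolve to the torus sites of `Setup.lean`; re-export the `ℤ^d` sites of `B7Prop1Explicit`.
export B7Prop1Explicit (Site)

variable {d : ℕ}
variable {𝔸 : Type*} [NormedRing 𝔸] [NormedAlgebra ℂ 𝔸] [CompleteSpace 𝔸] [NormOneClass 𝔸]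

/-! ## §1 (127) at the first step over the flat background: the composite IS the one-step map, and (122) on it -/

section Bookkeeping

variable (L : ℕ) (B : Site d → Fin d → 𝔸) (z : Site d) (κ : Fin d)

omit [NormOneClass 𝔸] in
/-- **(127) at `j = 0 → 1`, `U₀ = 1`**: `Q₁(1, B)` at the coarse bond `(z, κ)` is the one-step map (121) `Q(1, B)` at the `L`-bond `⟨Lz, Lz + Le_κ⟩`
(`Ū₀⁰ = U₀ = 1`, `Q₀(1, B) = B`). [cite: Balaban1985Averaging, (127) p.37, (121) p.36] -/
theorem logCovIter_one_level_one_eq_Qcov :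
    logCovIter L (1 : Site d → Fin d → 𝔸ˣ) B 1 z κ = Qcov L (1 : Site d → Fin d → 𝔸ˣ) B ((L : ℤ) • z) κ := by
  rw [show (1 : ℕ) = 0 + 1 from rfl, logCovIter_succ, logCovIter_zero, avgIter_zero]

omit [NormOneClass 𝔸] in
/-- **the linear parts at `j = 0 → 1`, `U₀ = 1`**: `L·Q₁(1)B` at `(z, κ)` is the linear part (122) `L(Q(1)B)` at `⟨Lz, Lz + Le_κ⟩`.
[cite: Balaban1985Averaging, p.38 (before (133)), (122) p.36] -/
theorem linCovIter_one_level_one_eq_linQcov :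
    linCovIter L (1 : Site d → Fin d → 𝔸ˣ) B 1 z κ = linQcov L (1 : Site d → Fin d → 𝔸ˣ) B ((L : ℤ) • z) κ := by
  rw [show (1 : ℕ) = 0 + 1 from rfl, linCovIter_succ, linCovIter_zero, avgIter_zero]

omit [NormOneClass 𝔸] in
/-- **(122) READ ON THE LEVEL-1 FLAT COMPOSITE**: «Q(V₀, A, c) = L(Q(V₀)A)_c + C(V₀, A, c)» at `V₀ = 1` for the composites (127):
`Q₁(1, B)(z, κ) = L·Q₁(1)B (z, κ) + C(1, B, ⟨Lz, Lz + Le_κ⟩)`. [cite: Balaban1985Averaging, (122) p.36, (127) p.37] -/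
theorem logCovIter_one_level_one_eq_lin_add_Ccov :
    logCovIter L (1 : Site d → Fin d → 𝔸ˣ) B 1 z κ =
      linCovIter L (1 : Site d → Fin d → 𝔸ˣ) B 1 z κ + Ccov L (1 : Site d → Fin d → 𝔸ˣ) B ((L : ℤ) • z) κ := by
  rw [logCovIter_one_level_one_eq_Qcov, linCovIter_one_level_one_eq_linQcov, Qcov_eq_linQcov_add_Ccov]

end Bookkeeping

/-! ## §2 ★ (123) on the level-1 flat composite: `‖Q₁(1, B)‖ ≤ ‖L·Q₁(1)B‖ + 131072(d+1)²L²·|B|²` -/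

section Remainder

/-- ★ **(123) ON THE LEVEL-1 FLAT COMPOSITE (127)**: for `L ≥ 1` and a bond field `B` with `sup_b ‖B b‖ ≤ a ≤ c₃(d, L)` (the radius of
`B7Prop3Flat.c3`), at every coarse bond `(z, κ)`:
`‖Q₁(1, B)(z, κ)‖ ≤ ‖L·Q₁(1)B (z, κ)‖ + 131072·(d+1)²·L²·a²` — (122) + (123) «|C(V₀, A, c)| ≤ C₁L²|A|²» with print's constant `C₁ = 131072(d+1)²`
made explicit by `B7Eq123General.norm_Ccov_le_explicit`, applied at the flat background, which is regular with `‖W_x(1) − 1‖ = 0` (`B8Ineq130.Wcx_one`).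
[cite: Balaban1985Averaging, Proposition 3 (122)–(123) p.36, (127) p.37] -/
theorem norm_logCovIter_one_level_one_le {L : ℕ} (hL : 1 ≤ L) (B : Site d → Fin d → 𝔸) {a : ℝ} (ha : 0 ≤ a)
    (hB : ∀ x κ, ‖B x κ‖ ≤ a) (hac : a ≤ c3 d L) (z : Site d) (κ : Fin d) :
    ‖logCovIter L (1 : Site d → Fin d → 𝔸ˣ) B 1 z κ‖ ≤
      ‖linCovIter L (1 : Site d → Fin d → 𝔸ˣ) B 1 z κ‖ + 131072 * ((d : ℝ) + 1) ^ 2 * (L : ℝ) ^ 2 * a ^ 2 := by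
  have hreg : ∀ r : Fin d → Fin L,
      ‖((Wcx L (1 : Site d → Fin d → 𝔸ˣ) ((L : ℤ) • z) κ (boxVec L r) : 𝔸ˣ) : 𝔸) - 1‖ ≤ (0 : ℝ) := by
    intro r
    rw [B8Ineq130.Wcx_one, Units.val_one, sub_self, norm_zero]
  have hC := norm_Ccov_le_explicit (d := d) hL (V₀ := (1 : Site d → Fin d → 𝔸ˣ)) (fun _ _ => (U1 𝔸).one_mem) B ha hB hac
    ((L : ℤ) • z) κ (α := 0) (by norm_num) hreg
  rw [logCovIter_one_level_one_eq_lin_add_Ccov]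
  exact (norm_add_le _ _).trans (by linarith)

/-- ★ **… WITH VANISHING LINEAR PART**: if moreover `L·Q₁(1)B (z, κ) = 0` then `‖Q₁(1, B)(z, κ)‖ ≤ 131072·(d+1)²·L²·a²` — the «(max phase)²» shape
(the case of dag-n05-c's interior-shell gauge mode on the level-1 tower bonds, `B8SockB9P3ShellModeVacuityUniv.linCovIter_one_grad_level_one` with equal
block sums). [cite: Balaban1985Averaging, Proposition 3 (122)–(123) p.36, (127) p.37] -/
theorem norm_logCovIter_one_level_one_le_of_lin_eq_zero {L : ℕ} (hL : 1 ≤ L) (B : Site d → Fin d → 𝔸) {a : ℝ} (ha : 0 ≤ a)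
    (hB : ∀ x κ, ‖B x κ‖ ≤ a) (hac : a ≤ c3 d L) (z : Site d) (κ : Fin d)
    (hlin : linCovIter L (1 : Site d → Fin d → 𝔸ˣ) B 1 z κ = 0) :
    ‖logCovIter L (1 : Site d → Fin d → 𝔸ˣ) B 1 z κ‖ ≤ 131072 * ((d : ℝ) + 1) ^ 2 * (L : ℝ) ^ 2 * a ^ 2 := by
  have h := norm_logCovIter_one_level_one_le hL B ha hB hac z κ
  rwa [hlin, norm_zero, zero_add] at h

/-- **… IN THE CURRENCY `B = iηA′`** of [Balaban1985RegularSpaces] (1.42) (`B8Eq146AExpansion.iEta`): for `η ≥ 0`, `sup ‖A′‖ ≤ T` with `ηT ≤ c₃(d, L)`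
and vanishing linear part, `‖Q₁(1, iηA′)(z, κ)‖ ≤ 131072·(d+1)²·L²·(ηT)²`. [cite: Balaban1985Averaging, Proposition 3 (123) p.36, (127) p.37; Balaban1985RegularSpaces, (1.42) p.83] -/
theorem norm_logCovIter_iEta_one_level_one_le_of_lin_eq_zero {L : ℕ} (hL : 1 ≤ L) {η : ℝ} (hη : 0 ≤ η)
    (A' : Site d → Fin d → 𝔸) {T : ℝ} (hT : 0 ≤ T) (hA' : ∀ x κ, ‖A' x κ‖ ≤ T) (hηT : η * T ≤ c3 d L) (z : Site d) (κ : Fin d)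
    (hlin : linCovIter L (1 : Site d → Fin d → 𝔸ˣ) (iEta η A') 1 z κ = 0) :
    ‖logCovIter L (1 : Site d → Fin d → 𝔸ˣ) (iEta η A') 1 z κ‖ ≤ 131072 * ((d : ℝ) + 1) ^ 2 * (L : ℝ) ^ 2 * (η * T) ^ 2 :=
  norm_logCovIter_one_level_one_le_of_lin_eq_zero hL (iEta η A') (mul_nonneg hη hT) (fun x κ => norm_iEta_le hη hA' x κ) hηT z κ
    hlin

end Remainder

#print axioms norm_logCovIter_one_level_one_le
#print axioms norm_logCovIter_iEta_one_level_one_le_of_lin_eq_zero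

end Literature.MathematicalPhysics.QuantumFieldTheory.Balaban1983to89.B7Eq123LogCovIterLevelOne

end
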